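import Summits.Parity.GeneralizedHardyLittlewood.Theorems.BeyondDiagonalBeatsQuarter.OffDiagDualStrataCount
import Literature.NumberTheory.Sieve.DivisorBound
import HarnessLib

/-!
# Route `PrimeLevelFamEdge`, crux K_B (stmt-Parity-20343), line `diagonal_kernel_split` rev 4, plan Ω,
# worker key L3 (part 5) `OffDiagDualHyperbolaSharp`: the SHARP count of dual frequencies in a box by the
# `s`-parametrisation `h₁h₂ = n₀ + c·s` and the divisor function —
# `#{(h₁,h₂) ∈ [-A₁,A₁]×[-A₂,A₂] : h₁h₂ ≡ n₀ (mod c)} ≤ Σ_{|s| ≤ (A₁A₂+|n₀|)/c} 2τ(|n₀ + cs|)` (`c ∤ n₀`)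

L3 parts 2–4 count the hyperbola `h₁h₂ ≡ γ (mod c)` in a dual box class by class: `≤ (2A₁+1)(2A₂/c+1)`. That is
sharp only when `A₂ ≥ c`; in the regime of BLUEPRINT §2 (`H_j = c(1+Z)/K_j`, boxes `K_j ≈ √q`) one has
`A₁A₂ ≳ c` but `A_j ≪ c`, and the true density is `≈ A₁A₂/c` («hyperbola density `H₁H₂/(qr)`»). The sharp
count comes from GATE G2 row a6 (`h₁h₂ = αβ + qr·s`, `OffDiagDual.dual_congruence_iff_exists_int`): the pair
`(h₁,h₂)` is determined by `(s, h₁)` with `|s| ≤ (A₁A₂+|n₀|)/c` and `h₁ ∣ n₀ + cs ≠ 0`. This file: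
* **`card_hyperbolaBox_le_sum_card_divisors`** — for `c ≥ 1`, `c ∤ n₀`:
  `#{(h₁,h₂) ∈ [-A₁,A₁]×[-A₂,A₂] : h₁h₂ ≡ n₀ (mod c)} ≤ Σ_{s ∈ [-S₀,S₀]} 2·τ(|n₀ + cs|)`, `S₀ = ⌊(A₁A₂+|n₀|)/c⌋`;
* **`card_hyperbolaBox_le_rpow`** — with the tree's divisor bound `τ(n) ≤ C_δ n^δ`:
  `≤ (2(A₁A₂+|n₀|)/c + 1)·2C_δ·(A₁A₂+2|n₀|)^δ`;
* **`sum_dualCount_box_le_sharp`** — on every stratum `N_c(a,β;h) ≤ gcd(a,c)·𝟙[h₁h₂ ≡ aβ]`, hence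
  `Σ_{box} N_c(a,β;h) ≤ gcd(a,c)·Σ_{|s|≤S₀} 2τ(|aβ + cs|)` when `c ∤ aβ` (prime level: `q ∤ αβ` for `α, β < q`);
* **`sum_dualBox_norm_le_sharp`** — the trivial ledger of one truncated dual box with the sharp count:
  `Σ_{box} ‖Φ̂_i(h/(qr))‖·N ≤ bulk·gcd(α,qr)·Σ_{|s|≤S₀} 2τ(|αβ + qrs|)`.
Elementary counting; nothing about the heart. Helper (`--supports stmt-Parity-20343`); standard axioms.
«The programme SEARCHES and TYPES; no claim about Landau–Siegel zeros, Theorems 1–2 of arXiv:2211.02515 or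
a repaired Margin232 until a kernel theorem says so.»
-/

noncomputable section

open Finset
open scoped Real

namespace Summit.Parity.GeneralizedHardyLittlewood.Theorems.BeyondDiagonalBeatsQuarter.OffDiag

open Literature.NumberTheory.LFunctions Literature.NumberTheory.LFunctions.KMV2000
open Literature.Analysis.FunctionSpaces (besselJ)
open Literature.NumberTheory.Sieve.FriedlanderIwaniecPrimes (fourier2)

/-! ### §1. The `s`-parametrisation count -/

/-- **The sharp hyperbola count.** For `c ≥ 1`, `A₁, A₂ ∈ ℕ` and `n₀ ∈ ℤ` with `c ∤ n₀`:
`#{(h₁,h₂) ∈ [-A₁,A₁]×[-A₂,A₂] : h₁h₂ ≡ n₀ (mod c)} ≤ Σ_{s ∈ [-S₀,S₀]} 2·τ(|n₀ + c·s|)`,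
`S₀ = ⌊(A₁A₂ + |n₀|)/c⌋` (write `h₁h₂ = n₀ + cs`; then `|s| ≤ S₀`, `h₁ ≠ 0`, `h₁ ∣ n₀ + cs ≠ 0`, and `h₂` is
determined by `(s, h₁)`). [cite: KowalskiMichelVanderKam2000, Lemma 3.3 p. 9 — derivation] -/
theorem card_hyperbolaBox_le_sum_card_divisors (c : ℕ) (hc : 0 < c) (A₁ A₂ : ℕ) {n₀ : ℤ}
    (hn : ¬ (c : ℤ) ∣ n₀) :
    (((Finset.Icc (-(A₁ : ℤ)) A₁) ×ˢ (Finset.Icc (-(A₂ : ℤ)) A₂)).filter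
        (fun h : ℤ × ℤ ↦ ((h.1 * h.2 : ℤ) : ZMod c) = (n₀ : ZMod c))).card ≤
      ∑ s ∈ Finset.Icc (-(((A₁ * A₂ + n₀.natAbs) / c : ℕ) : ℤ)) (((A₁ * A₂ + n₀.natAbs) / c : ℕ) : ℤ),
        2 * ((n₀ + c * s).natAbs.divisors.card) := by
  classical
  have hcz : (0 : ℤ) < c := by exact_mod_cast hc
  set S₀ : ℕ := (A₁ * A₂ + n₀.natAbs) / c with hS₀
  set S := ((Finset.Icc (-(A₁ : ℤ)) A₁) ×ˢ (Finset.Icc (-(A₂ : ℤ)) A₂)).filter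
    (fun h : ℤ × ℤ ↦ ((h.1 * h.2 : ℤ) : ZMod c) = (n₀ : ZMod c)) with hSdef
  -- the parameter `s(h) = (h₁h₂ − n₀)/c`
  set sOf : ℤ × ℤ → ℤ := fun h ↦ (h.1 * h.2 - n₀) / c with hsOf
  have hmem : ∀ h ∈ S, (-(A₁ : ℤ) ≤ h.1 ∧ h.1 ≤ A₁) ∧ (-(A₂ : ℤ) ≤ h.2 ∧ h.2 ≤ A₂) ∧
      (c : ℤ) ∣ h.1 * h.2 - n₀ := by
    intro h hh
    obtain ⟨hbox, hcong⟩ := Finset.mem_filter.1 hh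
    obtain ⟨h1, h2⟩ := Finset.mem_product.1 hbox
    refine ⟨Finset.mem_Icc.1 h1, Finset.mem_Icc.1 h2, ?_⟩
    exact (ZMod.intCast_eq_intCast_iff_dvd_sub n₀ (h.1 * h.2) c).1 (by push_cast at hcong ⊢; exact hcong.symm)
  have hprod : ∀ h ∈ S, h.1 * h.2 = n₀ + c * sOf h := by
    intro h hh
    have hd := (hmem h hh).2.2
    rw [hsOf]; simp only
    rw [Int.mul_ediv_cancel' hd]; ring
  have hne : ∀ h ∈ S, h.1 * h.2 ≠ 0 := by
    intro h hh h0
    apply hn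
    have hd := (hmem h hh).2.2
    rw [h0, zero_sub] at hd
    exact (dvd_neg).1 hd
  have h1ne : ∀ h ∈ S, h.1 ≠ 0 := fun h hh h0 ↦ hne h hh (by rw [h0, zero_mul])
  have hsabs : ∀ h ∈ S, (sOf h).natAbs ≤ S₀ := by
    intro h hh
    obtain ⟨⟨a1, a2⟩, ⟨b1, b2⟩, -⟩ := hmem h hh
    have hp := hprod h hh
    -- `|c s| = |h₁h₂ − n₀| ≤ A₁A₂ + |n₀|`
    have hh1 : h.1.natAbs ≤ A₁ := by
      rw [← Int.ofNat_le]; rw [Int.natCast_natAbs]; exact abs_le.2 ⟨a1, a2⟩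
    have hh2 : h.2.natAbs ≤ A₂ := by
      rw [← Int.ofNat_le]; rw [Int.natCast_natAbs]; exact abs_le.2 ⟨b1, b2⟩
    have hcs : c * (sOf h).natAbs ≤ A₁ * A₂ + n₀.natAbs := by
      have e : (c : ℤ) * sOf h = h.1 * h.2 - n₀ := by rw [hp]; ring
      have : ((c : ℤ) * sOf h).natAbs ≤ (h.1 * h.2).natAbs + n₀.natAbs := by
        rw [e]; exact Int.natAbs_sub_le _ _
      rw [Int.natAbs_mul, Int.natAbs_natCast, Int.natAbs_mul] at this
      exact this.trans (Nat.add_le_add_right (Nat.mul_le_mul hh1 hh2) _)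
    rw [hS₀]
    exact (Nat.le_div_iff_mul_le hc).2 (by rw [mul_comm]; exact hcs)
  -- the target: pairs `(s, ±d)` with `d ∣ |n₀ + cs|`
  set T : Finset (ℤ × ℤ) := (Finset.Icc (-(S₀ : ℤ)) S₀).biUnion (fun s ↦
    ((n₀ + c * s).natAbs.divisors.image (fun d : ℕ ↦ (s, (d : ℤ)))) ∪
      ((n₀ + c * s).natAbs.divisors.image (fun d : ℕ ↦ (s, -(d : ℤ))))) with hT
  have hmaps : ∀ h ∈ S, (sOf h, h.1) ∈ T := by
    intro h hh
    have hs := hsabs h hh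
    have hsI : sOf h ∈ Finset.Icc (-(S₀ : ℤ)) S₀ := by
      rw [Finset.mem_Icc, ← abs_le, ← Int.natCast_natAbs]; exact_mod_cast hs
    rw [hT, Finset.mem_biUnion]
    refine ⟨sOf h, hsI, ?_⟩
    have hn0 : (n₀ + c * sOf h) ≠ 0 := by rw [← hprod h hh]; exact hne h hh
    have hdvd : h.1.natAbs ∈ (n₀ + c * sOf h).natAbs.divisors := by
      rw [Nat.mem_divisors]
      refine ⟨Int.natAbs_dvd_natAbs.2 ?_, Int.natAbs_ne_zero.2 hn0⟩
      rw [← hprod h hh]; exact Dvd.intro _ rfl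
    rw [Finset.mem_union, Finset.mem_image, Finset.mem_image]
    rcases le_or_gt 0 h.1 with hpos | hneg
    · left; exact ⟨h.1.natAbs, hdvd, by rw [Int.natAbs_of_nonneg hpos]⟩
    · right; refine ⟨h.1.natAbs, hdvd, ?_⟩
      rw [Int.ofNat_natAbs_of_nonpos hneg.le, neg_neg]
  have hinj : Set.InjOn (fun h : ℤ × ℤ ↦ (sOf h, h.1)) (S : Set (ℤ × ℤ)) := by
    intro h hh h' hh' he
    simp only [Prod.mk.injEq] at he
    obtain ⟨hs, h1⟩ := he
    have hp := hprod h (Finset.mem_coe.1 hh)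
    have hp' := hprod h' (Finset.mem_coe.1 hh')
    have : h.1 * h.2 = h.1 * h'.2 := by rw [hp, hs, ← hp', h1]
    exact Prod.ext h1 (mul_left_cancel₀ (h1ne h (Finset.mem_coe.1 hh)) this)
  have hcard := Finset.card_le_card_of_injOn (fun h : ℤ × ℤ ↦ (sOf h, h.1)) hmaps hinj
  refine hcard.trans ((Finset.card_biUnion_le).trans (Finset.sum_le_sum fun s _ ↦ ?_))
  calc _ ≤ ((n₀ + c * s).natAbs.divisors.image (fun d : ℕ ↦ (s, (d : ℤ)))).card +
        ((n₀ + c * s).natAbs.divisors.image (fun d : ℕ ↦ (s, -(d : ℤ)))).card := Finset.card_union_le _ _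
    _ ≤ (n₀ + c * s).natAbs.divisors.card + (n₀ + c * s).natAbs.divisors.card :=
        Nat.add_le_add Finset.card_image_le Finset.card_image_le
    _ = 2 * (n₀ + c * s).natAbs.divisors.card := by ring

/-- **The sharp count with the divisor bound**: with `τ(n) ≤ C·n^δ` (`δ > 0`, the tree's
`exists_card_divisors_le_mul_rpow'`), for `c ≥ 1`, `c ∤ n₀`:
`#{(h₁,h₂) ∈ [-A₁,A₁]×[-A₂,A₂] : h₁h₂ ≡ n₀ (mod c)} ≤ (2(A₁A₂+|n₀|)/c + 1)·2C·(A₁A₂ + 2|n₀|)^δ`.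
[cite: HardyWright2008, Theorem 315; KowalskiMichelVanderKam2000, Lemma 3.3 p. 9 — derivation] -/
theorem card_hyperbolaBox_le_rpow (c : ℕ) (hc : 0 < c) (A₁ A₂ : ℕ) {n₀ : ℤ} (hn : ¬ (c : ℤ) ∣ n₀)
    {δ C : ℝ} (hδ : 0 ≤ δ) (hC : ∀ n : ℕ, ((n.divisors.card : ℕ) : ℝ) ≤ C * (n : ℝ) ^ δ) :
    ((((Finset.Icc (-(A₁ : ℤ)) A₁) ×ˢ (Finset.Icc (-(A₂ : ℤ)) A₂)).filter
        (fun h : ℤ × ℤ ↦ ((h.1 * h.2 : ℤ) : ZMod c) = (n₀ : ZMod c))).card : ℝ) ≤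
      (2 * (((A₁ : ℝ) * A₂ + n₀.natAbs) / c) + 1) * (2 * C * ((A₁ : ℝ) * A₂ + 2 * n₀.natAbs) ^ δ) := by
  have hC0 : 0 ≤ C := by
    have h := hC 1
    simp at h
    linarith
  set S₀ : ℕ := (A₁ * A₂ + n₀.natAbs) / c with hS₀
  have hcount := card_hyperbolaBox_le_sum_card_divisors c hc A₁ A₂ hn
  -- each divisor count ≤ C (A₁A₂ + 2|n₀|)^δ
  have hτ : ∀ s ∈ Finset.Icc (-(S₀ : ℤ)) S₀,
      (((n₀ + c * s).natAbs.divisors.card : ℕ) : ℝ) ≤ C * ((A₁ : ℝ) * A₂ + 2 * n₀.natAbs) ^ δ := by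
    intro s hs
    rw [Finset.mem_Icc] at hs
    refine (hC _).trans (mul_le_mul_of_nonneg_left (Real.rpow_le_rpow (Nat.cast_nonneg _) ?_ hδ) hC0)
    have h1 : (n₀ + c * s).natAbs ≤ n₀.natAbs + c * s.natAbs := by
      calc (n₀ + c * s).natAbs ≤ n₀.natAbs + (c * s : ℤ).natAbs := Int.natAbs_add_le _ _
        _ = n₀.natAbs + c * s.natAbs := by rw [Int.natAbs_mul, Int.natAbs_natCast]
    have h2 : c * s.natAbs ≤ A₁ * A₂ + n₀.natAbs := by
      have hs' : s.natAbs ≤ S₀ := by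
        rw [← Int.ofNat_le, Int.natCast_natAbs]; exact abs_le.2 hs
      calc c * s.natAbs ≤ c * S₀ := Nat.mul_le_mul_left c hs'
        _ ≤ A₁ * A₂ + n₀.natAbs := Nat.mul_div_le _ _
    have : ((n₀ + c * s).natAbs : ℝ) ≤ (n₀.natAbs : ℝ) + ((A₁ * A₂ + n₀.natAbs : ℕ) : ℝ) := by
      exact_mod_cast h1.trans (Nat.add_le_add_left h2 _)
    push_cast at this
    linarith
  have hS₀le : ((S₀ : ℕ) : ℝ) ≤ ((A₁ : ℝ) * A₂ + n₀.natAbs) / c := by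
    rw [le_div_iff₀ (by exact_mod_cast hc)]
    exact_mod_cast Nat.div_mul_le_self (A₁ * A₂ + n₀.natAbs) c
  calc _ ≤ ((∑ s ∈ Finset.Icc (-(S₀ : ℤ)) S₀, 2 * ((n₀ + c * s).natAbs.divisors.card) : ℕ) : ℝ) := by
        exact_mod_cast hcount
    _ = ∑ s ∈ Finset.Icc (-(S₀ : ℤ)) S₀, 2 * (((n₀ + c * s).natAbs.divisors.card : ℕ) : ℝ) := by push_cast; rfl
    _ ≤ ∑ s ∈ Finset.Icc (-(S₀ : ℤ)) S₀, 2 * (C * ((A₁ : ℝ) * A₂ + 2 * n₀.natAbs) ^ δ) :=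
        Finset.sum_le_sum fun s hs ↦ by linarith [hτ s hs]
    _ = ((Finset.Icc (-(S₀ : ℤ)) S₀).card : ℝ) * (2 * C * ((A₁ : ℝ) * A₂ + 2 * n₀.natAbs) ^ δ) := by
        rw [Finset.sum_const, nsmul_eq_mul]; ring
    _ = (2 * (S₀ : ℝ) + 1) * (2 * C * ((A₁ : ℝ) * A₂ + 2 * n₀.natAbs) ^ δ) := by
        rw [Int.card_Icc]
        congr 1
        rw [show (S₀ : ℤ) + 1 - -(S₀ : ℤ) = ((2 * S₀ + 1 : ℕ) : ℤ) by push_cast; ring, Int.toNat_natCast]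
        push_cast; ring
    _ ≤ _ := by
        refine mul_le_mul_of_nonneg_right (by linarith) (by positivity)

/-! ### §2. The dual multiplicities, sharply -/

section Sharp

variable {c : ℕ} [NeZero c]

/-- On every stratum the multiplicity is supported on the hyperbola and bounded by the gcd:
`N_c(a,β;h₁,h₂) ≤ gcd(a,c)·𝟙[h₁h₂ = aβ]`. [folklore] -/
theorem dualCount_natCast_le_gcd_ite (a b : ℕ) (h₁ h₂ : ℤ) :
    (dualCount c (a : ZMod c) (b : ZMod c) (h₁ : ZMod c) (h₂ : ZMod c) : ℝ) ≤
      if ((h₁ * h₂ : ℤ) : ZMod c) = ((a * b : ℕ) : ZMod c) then (Nat.gcd a c : ℝ) else 0 := by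
  classical
  split_ifs with hh
  · exact_mod_cast dualCount_natCast_le_gcd a (b : ZMod c) (h₁ : ZMod c) (h₂ : ZMod c)
  · have : dualCount c (a : ZMod c) (b : ZMod c) (h₁ : ZMod c) (h₂ : ZMod c) = 0 := by
      refine dualCount_eq_zero_of_ne fun heq ↦ hh ?_
      push_cast; exact heq
    rw [this, Nat.cast_zero]

/-- **The multiplicities summed over a dual box, sharply**: for `c ∤ ab`,
`Σ_{(h₁,h₂) ∈ [-A₁,A₁]×[-A₂,A₂]} N_c(a,b;h₁,h₂) ≤ gcd(a,c)·Σ_{|s| ≤ S₀} 2τ(|ab + cs|)`, `S₀ = ⌊(A₁A₂+ab)/c⌋`.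
[cite: KowalskiMichelVanderKam2000, Lemma 3.3 p. 9 — derivation] -/
theorem sum_dualCount_box_le_sharp (a b : ℕ) (hab : ¬ c ∣ a * b) (A₁ A₂ : ℕ) :
    ∑ h ∈ (Finset.Icc (-(A₁ : ℤ)) A₁) ×ˢ (Finset.Icc (-(A₂ : ℤ)) A₂),
        (dualCount c (a : ZMod c) (b : ZMod c) (h.1 : ZMod c) (h.2 : ZMod c) : ℝ) ≤
      (Nat.gcd a c : ℝ) *
        ∑ s ∈ Finset.Icc (-(((A₁ * A₂ + a * b) / c : ℕ) : ℤ)) (((A₁ * A₂ + a * b) / c : ℕ) : ℤ),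
          2 * ((((a * b : ℕ) : ℤ) + c * s).natAbs.divisors.card : ℝ) := by
  classical
  have hc : 0 < c := Nat.pos_of_ne_zero (NeZero.ne c)
  have hn : ¬ (c : ℤ) ∣ ((a * b : ℕ) : ℤ) := fun h ↦ hab (Int.natCast_dvd_natCast.1 h)
  have hcount := card_hyperbolaBox_le_sum_card_divisors c hc A₁ A₂ hn
  rw [Int.natAbs_natCast] at hcount
  set I := (Finset.Icc (-(A₁ : ℤ)) A₁) ×ˢ (Finset.Icc (-(A₂ : ℤ)) A₂) with hI
  calc ∑ h ∈ I, (dualCount c (a : ZMod c) (b : ZMod c) (h.1 : ZMod c) (h.2 : ZMod c) : ℝ)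
      ≤ ∑ h ∈ I, (if ((h.1 * h.2 : ℤ) : ZMod c) = ((a * b : ℕ) : ZMod c) then (Nat.gcd a c : ℝ) else 0) :=
        Finset.sum_le_sum fun h _ ↦ dualCount_natCast_le_gcd_ite a b h.1 h.2
    _ = (Nat.gcd a c : ℝ) *
          ((I.filter (fun h : ℤ × ℤ ↦ ((h.1 * h.2 : ℤ) : ZMod c) = (((a * b : ℕ) : ℤ) : ZMod c))).card : ℝ) := by
        rw [← Finset.sum_filter, Finset.sum_const, nsmul_eq_mul, mul_comm]
        push_cast; rfl
    _ ≤ (Nat.gcd a c : ℝ) * ((∑ s ∈ Finset.Icc (-(((A₁ * A₂ + a * b) / c : ℕ) : ℤ))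
          (((A₁ * A₂ + a * b) / c : ℕ) : ℤ), 2 * ((((a * b : ℕ) : ℤ) + c * s).natAbs.divisors.card) : ℕ) : ℝ) :=
        mul_le_mul_of_nonneg_left (by exact_mod_cast hcount) (Nat.cast_nonneg _)
    _ = _ := by push_cast; rfl

end Sharp

/-! ### §3. The trivial ledger of a truncated dual box with the sharp count -/

section Ledger

variable {q d₁ d₂ α β r : ℕ}

/-- **The trivial ledger, sharp form.** Let `q, d₁, d₂, α, β ≥ 1`, `qr ≥ 1`, `qr ∤ αβ` (prime level: `α, β < q`),
`J ≥ 0` with `|J₁(x)| ≤ J` for `x ≥ Z/2`. Then for all `A₁, A₂`: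
`Σ_{(h₁,h₂) ∈ [-A₁,A₁]×[-A₂,A₂]} ‖Φ̂_i(h/(qr))‖·N_{qr}(α,β;h) ≤ bulk·gcd(α,qr)·Σ_{|s| ≤ S₀} 2τ(|αβ + qrs|)`,
`S₀ = ⌊(A₁A₂+αβ)/(qr)⌋` — the density `≈ A₁A₂/(qr)` of BLUEPRINT §2 up to the divisor function.
[cite: KowalskiMichelVanderKam2000, (21)–(23) p. 12 and Lemma 3.3 p. 9 — derivation] -/
theorem sum_dualBox_norm_le_sharp [NeZero q] [NeZero (q * r)] (hd₁ : 1 ≤ d₁) (hd₂ : 1 ≤ d₂) (hα : 1 ≤ α)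
    (hβ : 1 ≤ β) (hndvd : ¬ q * r ∣ α * β) (i : ℕ × ℕ) {J : ℝ} (hJ0 : 0 ≤ J)
    (hJ : ∀ x : ℝ, 4 * π * Real.sqrt ((α : ℝ) * (β : ℝ) * ((2 : ℝ) ^ i.1 * 2 ^ i.2)) / ((q : ℝ) * r) / 2 ≤ x →
      |besselJ 1 x| ≤ J) (A₁ A₂ : ℕ) :
    ∑ h ∈ (Finset.Icc (-(A₁ : ℤ)) A₁) ×ˢ (Finset.Icc (-(A₂ : ℤ)) A₂),
        ‖fourier2 (boxWeight q d₁ d₂ α β r i) (h.1 / (q * r : ℕ)) (h.2 / (q * r : ℕ))‖ *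
          (dualCount (q * r) (α : ZMod (q * r)) (β : ZMod (q * r)) (h.1 : ZMod (q * r)) (h.2 : ZMod (q * r)) : ℝ) ≤
      (9 / 4 * ((2 : ℝ) ^ i.1 * 2 ^ i.2) *
          (((d₁ : ℝ) * d₂ * ((2 : ℝ) ^ i.1 * 2 ^ i.2) / 4) ^ (-(1 / 2 : ℝ)) *
            cutoffW ((d₁ : ℝ) * d₂ * ((2 : ℝ) ^ i.1 * 2 ^ i.2) / 4 / qhat q ^ 2) * (r : ℝ)⁻¹ * J)) *
        ((Nat.gcd α (q * r) : ℝ) *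
          ∑ s ∈ Finset.Icc (-(((A₁ * A₂ + α * β) / (q * r) : ℕ) : ℤ)) (((A₁ * A₂ + α * β) / (q * r) : ℕ) : ℤ),
            2 * ((((α * β : ℕ) : ℤ) + ((q * r : ℕ) : ℤ) * s).natAbs.divisors.card : ℝ)) := by
  set B : ℝ := 9 / 4 * ((2 : ℝ) ^ i.1 * 2 ^ i.2) *
    (((d₁ : ℝ) * d₂ * ((2 : ℝ) ^ i.1 * 2 ^ i.2) / 4) ^ (-(1 / 2 : ℝ)) *
      cutoffW ((d₁ : ℝ) * d₂ * ((2 : ℝ) ^ i.1 * 2 ^ i.2) / 4 / qhat q ^ 2) * (r : ℝ)⁻¹ * J) with hB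
  have hB0 : 0 ≤ B := by
    have := cutoffW_nonneg ((d₁ : ℝ) * d₂ * ((2 : ℝ) ^ i.1 * 2 ^ i.2) / 4 / qhat q ^ 2)
    positivity
  have hbulk : ∀ h : ℤ × ℤ, ‖fourier2 (boxWeight q d₁ d₂ α β r i) (h.1 / (q * r : ℕ)) (h.2 / (q * r : ℕ))‖ ≤ B :=
    fun h ↦ norm_fourier2_boxWeight_le hd₁ hd₂ hα hβ i hJ0 hJ _ _
  have hcount := sum_dualCount_box_le_sharp (c := q * r) α β hndvd A₁ A₂
  calc _ ≤ ∑ h ∈ (Finset.Icc (-(A₁ : ℤ)) A₁) ×ˢ (Finset.Icc (-(A₂ : ℤ)) A₂),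
          B * (dualCount (q * r) (α : ZMod (q * r)) (β : ZMod (q * r)) (h.1 : ZMod (q * r))
            (h.2 : ZMod (q * r)) : ℝ) :=
        Finset.sum_le_sum fun h _ ↦ mul_le_mul_of_nonneg_right (hbulk h) (Nat.cast_nonneg _)
    _ = B * ∑ h ∈ (Finset.Icc (-(A₁ : ℤ)) A₁) ×ˢ (Finset.Icc (-(A₂ : ℤ)) A₂),
          (dualCount (q * r) (α : ZMod (q * r)) (β : ZMod (q * r)) (h.1 : ZMod (q * r))
            (h.2 : ZMod (q * r)) : ℝ) := by rw [Finset.mul_sum]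
    _ ≤ _ := mul_le_mul_of_nonneg_left hcount hB0

/-- **Prime level supplies `qr ∤ αβ`**: for `q` prime and `1 ≤ α, β < q`. [folklore] -/
theorem not_mul_dvd_mul_primeLevel (hq : q.Prime) (hα : 1 ≤ α) (hαq : α < q) (hβ : 1 ≤ β) (hβq : β < q)
    (r : ℕ) : ¬ q * r ∣ α * β := by
  intro h
  have hq' : q ∣ α * β := (Dvd.intro _ rfl : q ∣ q * r).trans h
  rcases (Nat.Prime.dvd_mul hq).1 hq' with h1 | h2
  · exact absurd (Nat.le_of_dvd (by omega) h1) (by omega)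
  · exact absurd (Nat.le_of_dvd (by omega) h2) (by omega)

end Ledger

end Summit.Parity.GeneralizedHardyLittlewood.Theorems.BeyondDiagonalBeatsQuarter.OffDiag
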